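import Summits.HubbardSuperconductivity.HubbardSuperconductivity.Theorems.AnisotropyChordTransferFibre3DiagonalSum
import Summits.HubbardSuperconductivity.HubbardSuperconductivity.Theorems.AnisotropyChordTransferFibre3DiagRotation
import Summits.HubbardSuperconductivity.HubbardSuperconductivity.Theorems.AnisotropyChordTransferFibre3ZSquareKernel

/-!
# Route `AnisotropyChord` / H0 rotor rung: the DIAGONAL VALUES of the ℤ² kernel — `a_∞(n,n) = (1/π)Σ_{k<n} 1/(2k+1)`; `a_∞(1,1) = 1/π`, `a_∞(2,2) = 4/(3π)`, `a_∞(3,3) = 23/(15π)`; the window `0 ≤ y ≤ x ≤ 3` equals `aInfKT` unconditionally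

p2 g2's `…Fibre3ZSquareKernel` built the modulus-independent ℤ² kernel `aZ2` (dyadic limit of the torus kernels at `λ = 0`),
its symmetries, `a_∞(1,0) = 1/4`, harmonicity, and the window as affine functions of the «transcendental inputs `t = a_∞(1,1)`
(classically `1/π`) and `a_∞(2,2)`, NOT claimed».  This file PROVES them from p3's `diag_rotation` at `λ = 0` and `…DiagonalSum`:
* `row_inner_bound`/`row_bound`: each inner ring sum `S_p` is within `1/(2sin²u_p)` of `L/(4|sin u_p|)` (`u_p = πp/L`; sign flip
  `cos(v+π) = −cos v` for rows with `cos u_p < 0`), hence `|(1 − cos 2nu_p)(S_p − L/(4|sin u_p|))| ≤ n²` (`|sin nu| ≤ n|sin u|`);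
* `main_term_eq`: `Σ_{p<2L} (1 − cos 2nu_p)·L/(4|sin u_p|) = L·Σ_{k<n} cot((2k+1)π/(2L))` (`n ≤ L`; half-period shift,
  `(1 − cos 2nu)/sin u = 2Σ_{k<n} sin((2k+1)u)`, `Σ_{p<L} sin(p(2k+1)π/L) = cot((2k+1)π/(2L))`);
* ★★ `aKer_diag_approx`: **`|a_L(n,n;0) − (1/π)Σ_{k<n} 1/(2k+1)| ≤ n²/L + πn²/(8L²)`** (`2n ≤ L`; crude, explicit);
* ★★★ `aZ2_diag`: **`aZ2 n n = (1/π)Σ_{k<n} 1/(2k+1)`** (uniqueness of limits along `2^{k+1}`, p2's `tendsto_aKer_aZ2`);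
  `aZ2_one_one = 1/π`, `aZ2_two_two = 4/(3π)`, `aZ2_three_three = 23/(15π)`; the window with `t = 1/π` inserted
  (`aZ2_two_zero'` … `aZ2_three_two'`, the last by harmonicity at `(2,2)`) and ★★★ `aZ2_eq_aInfKT`: **`aZ2 x y = aInfKT x y` on
  `0 ≤ y ≤ x ≤ 3`, UNCONDITIONALLY** (p2's `aZ2_eq_aInfKT_of_quadraticLaw` assumed the measured `TorusKernelQuadraticLaw` ∀L) —
  the near-pair ℤ² skeleton `A∞ = 2·aZ2` of the HOLE₂ tail (`dualCert_threeQuarter_near`) is now explicit in `ℚ(1/π)`.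
Prover seat `hubbard-h0-rotor-p1` g25; helper for stmt-HubbardSuperconductivity-19089 (`--supports`).
WHAT THIS IS NOT: nothing here proves superconductivity in the Hubbard model (rotor TARGET as worded stays FALSE, g15);
classical lattice Green's function values serving ONE input (the ℤ² skeleton) of ONE input (HOLE₂) of ONE conditional reduction
(rung 19089).  Mathlib + tree imports only; no sorry, no axioms.
-/

set_option linter.dupNamespace false
set_option autoImplicit false

noncomputable section

open scoped BigOperators
open Complex Filter Topology

namespace Summit.HubbardSuperconductivity.HubbardSuperconductivity.Theorems.AnisotropyChord.Transfer.Fibre3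

variable (L : ℕ) [NeZero L]

/-! ## Row bounds for the diagonal formula at `λ = 0` -/

omit [NeZero L] in
/-- `1 − cos(2nu) ≤ 2n²sin²u`. [folklore] -/
theorem one_sub_cos_two_mul_le (n : ℕ) (u : ℝ) : 1 - Real.cos (2 * n * u) ≤ 2 * n ^ 2 * Real.sin u ^ 2 := by
  have h : 1 - Real.cos (2 * n * u) = 2 * Real.sin (n * u) ^ 2 := by
    rw [show 2 * (n : ℝ) * u = 2 * (n * u) by ring, Real.cos_two_mul, Real.cos_sq']; ring
  rw [h]
  -- `|sin(mu)| ≤ m|sin u|` by induction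
  have key : ∀ m : ℕ, |Real.sin (m * u)| ≤ m * |Real.sin u| := by
    intro m
    induction m with
    | zero => simp
    | succ m ih =>
      push_cast
      rw [add_mul, one_mul, Real.sin_add]
      calc |Real.sin (m * u) * Real.cos u + Real.cos (m * u) * Real.sin u|
          ≤ |Real.sin (m * u) * Real.cos u| + |Real.cos (m * u) * Real.sin u| := abs_add_le _ _
        _ = |Real.sin (m * u)| * |Real.cos u| + |Real.cos (m * u)| * |Real.sin u| := by rw [abs_mul, abs_mul]
        _ ≤ m * |Real.sin u| * 1 + 1 * |Real.sin u| := by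
            gcongr
            · exact Real.abs_cos_le_one u
            · exact Real.abs_cos_le_one _
        _ = (m + 1) * |Real.sin u| := by ring
  have h2 := key n
  have h3 : Real.sin (n * u) ^ 2 = |Real.sin (n * u)| ^ 2 := (sq_abs _).symm
  have h4 : Real.sin u ^ 2 = |Real.sin u| ^ 2 := (sq_abs _).symm
  rw [h3, h4]
  nlinarith [abs_nonneg (Real.sin (n * u)), abs_nonneg (Real.sin u),
    mul_le_mul h2 h2 (abs_nonneg _) (by positivity)]

/-- the inner ring sum of row `p` (`0 < p < 2L`, `p ≠ L`, i.e. `sin u_p ≠ 0`) is within `1/(2sin²u_p)` of `L/(4|sin u_p|)`. [folklore] -/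
theorem row_inner_bound (p : ℕ) (hs : Real.sin (Real.pi * p / L) ≠ 0) :
    |∑ j ∈ Finset.range L, 1 / (4 - 0 - 4 * Real.cos (Real.pi * p / L)
        * Real.cos (Real.pi * ((2 * j + p % 2 : ℕ) : ℝ) / L)) - L / (4 * |Real.sin (Real.pi * p / L)|)|
      ≤ 1 / (2 * Real.sin (Real.pi * p / L) ^ 2) := by
  have hL0 : (0 : ℝ) < L := by exact_mod_cast Nat.pos_of_ne_zero (NeZero.ne L)
  set u : ℝ := Real.pi * p / L with hu
  set c : ℝ := Real.cos u with hc
  have hsc : Real.sin u ^ 2 + c ^ 2 = 1 := Real.sin_sq_add_cos_sq u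
  have hs2 : 0 < Real.sin u ^ 2 := by positivity
  have hc2 : 1 - c ^ 2 = Real.sin u ^ 2 := by linarith
  have hcabs : |c| < 1 := by
    rw [← sq_lt_one_iff_abs_lt_one]; nlinarith
  have hsq : Real.sqrt (1 - c ^ 2) = |Real.sin u| := by rw [Real.abs_sin_eq_sqrt_one_sub_cos_sq]
  simp only [sub_zero]
  rcases le_or_gt 0 c with hc0 | hc0
  · -- `cos u ≥ 0`: directly
    have h := inner_sum_bound L hc0 (abs_lt.mp hcabs).2 (p % 2)
    rw [hsq, hc2] at h
    exact h
  · -- `cos u < 0`: shift the progression by half a period, `cos(v + π) = −cos v`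
    have hc0' : 0 ≤ -c := by linarith
    have hc1' : -c < 1 := by linarith [(abs_lt.mp hcabs).1]
    have h := inner_sum_bound L hc0' hc1' (p % 2 + L)
    rw [show (-c) ^ 2 = c ^ 2 by ring, hsq, hc2] at h
    have hterm : ∀ j : ℕ, 4 - 4 * -c * Real.cos (Real.pi * ((2 * j + (p % 2 + L) : ℕ) : ℝ) / L)
        = 4 - 4 * c * Real.cos (Real.pi * ((2 * j + p % 2 : ℕ) : ℝ) / L) := by
      intro j
      have e : Real.pi * ((2 * j + (p % 2 + L) : ℕ) : ℝ) / L = Real.pi * ((2 * j + p % 2 : ℕ) : ℝ) / L + Real.pi := by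
        push_cast; field_simp; ring
      rw [e, Real.cos_add_pi]; ring
    simp only [hterm] at h
    exact h

/-- ★ ROW BOUND: for every `p`, `|(1 − cos 2nu_p)·S_p − (1 − cos 2nu_p)·L/(4|sin u_p|)| ≤ n²` (rows with `sin u_p = 0` vanish). [folklore] -/
theorem row_bound (n p : ℕ) :
    |(1 - Real.cos (2 * Real.pi * n * p / L)) * ∑ j ∈ Finset.range L, 1 / (4 - 0 - 4 * Real.cos (Real.pi * p / L)
        * Real.cos (Real.pi * ((2 * j + p % 2 : ℕ) : ℝ) / L))
      - (1 - Real.cos (2 * Real.pi * n * p / L)) * (L / (4 * |Real.sin (Real.pi * p / L)|))| ≤ (n : ℝ) ^ 2 := by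
  have hL0 : (0 : ℝ) < L := by exact_mod_cast Nat.pos_of_ne_zero (NeZero.ne L)
  set u : ℝ := Real.pi * p / L with hu
  have e2 : 2 * Real.pi * n * p / L = 2 * n * u := by rw [hu]; ring
  rw [e2, ← mul_sub]
  by_cases hs : Real.sin u = 0
  · -- `sin u = 0`: then `u ∈ πℤ` and `cos(2nu) = 1`
    obtain ⟨m, hm⟩ := Real.sin_eq_zero_iff.mp hs
    have hcos : Real.cos (2 * n * u) = 1 := by
      rw [← hm, show 2 * (n : ℝ) * ((m : ℝ) * Real.pi) = ((n * m : ℤ) : ℝ) * (2 * Real.pi) by push_cast; ring]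
      exact Real.cos_int_mul_two_pi _
    rw [hcos, sub_self, zero_mul, abs_zero]
    positivity
  · have hb := row_inner_bound L p hs
    have hpre : 0 ≤ 1 - Real.cos (2 * n * u) := by linarith [Real.cos_le_one (2 * n * u)]
    have hle := one_sub_cos_two_mul_le n u
    have hs2 : 0 < Real.sin u ^ 2 := by positivity
    rw [abs_mul, abs_of_nonneg hpre]
    calc (1 - Real.cos (2 * n * u)) * |∑ j ∈ Finset.range L, 1 / (4 - 0 - 4 * Real.cos u
            * Real.cos (Real.pi * ((2 * j + p % 2 : ℕ) : ℝ) / L)) - L / (4 * |Real.sin u|)|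
        ≤ (2 * n ^ 2 * Real.sin u ^ 2) * (1 / (2 * Real.sin u ^ 2)) :=
          mul_le_mul hle hb (abs_nonneg _) (by positivity)
      _ = (n : ℝ) ^ 2 := by field_simp

/-- half-period shift invariance of the main summand. [folklore] -/
theorem main_summand_shift (n p : ℕ) :
    (1 - Real.cos (2 * Real.pi * n * ((L + p : ℕ) : ℝ) / L)) * (L / (4 * |Real.sin (Real.pi * ((L + p : ℕ) : ℝ) / L)|))
      = (1 - Real.cos (2 * Real.pi * n * p / L)) * (L / (4 * |Real.sin (Real.pi * p / L)|)) := by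
  have hL0 : (L : ℝ) ≠ 0 := by exact_mod_cast NeZero.ne L
  have e1 : 2 * Real.pi * n * ((L + p : ℕ) : ℝ) / L = 2 * Real.pi * n * p / L + n * (2 * Real.pi) := by
    push_cast; field_simp; ring
  have e2 : Real.pi * ((L + p : ℕ) : ℝ) / L = Real.pi * p / L + Real.pi := by
    push_cast; field_simp; ring
  rw [e1, Real.cos_add_nat_mul_two_pi, e2, Real.sin_add_pi, abs_neg]

/-- the main summand on the first half-period as an odd sine sum: for `p < L`,
`(1 − cos 2nu_p)·L/(4|sin u_p|) = (L/2)·Σ_{k<n} sin((2k+1)u_p)`. [folklore] -/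
theorem main_summand_eq_sum_sin (n p : ℕ) (hp : p < L) :
    (1 - Real.cos (2 * Real.pi * n * p / L)) * (L / (4 * |Real.sin (Real.pi * p / L)|))
      = (L : ℝ) / 2 * ∑ k ∈ Finset.range n, Real.sin ((2 * k + 1) * (Real.pi * p / L)) := by
  have hL0 : (0 : ℝ) < L := by exact_mod_cast Nat.pos_of_ne_zero (NeZero.ne L)
  set u : ℝ := Real.pi * p / L with hu
  have e2 : 2 * Real.pi * n * p / L = 2 * n * u := by rw [hu]; ring
  rw [e2]
  have hid := two_sin_mul_sum_sin_odd u n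
  rcases Nat.eq_zero_or_pos p with hp0 | hp0
  · -- `p = 0`: both sides vanish
    subst hp0
    have hu0 : u = 0 := by rw [hu]; simp
    simp [hu0]
  · have hupos : 0 < u := by rw [hu]; positivity
    have hult : u < Real.pi := by
      rw [hu, div_lt_iff₀ hL0]
      have : (p : ℝ) < L := by exact_mod_cast hp
      nlinarith [Real.pi_pos]
    have hsin : 0 < Real.sin u := Real.sin_pos_of_pos_of_lt_pi hupos hult
    set S := ∑ k ∈ Finset.range n, Real.sin ((2 * k + 1) * u) with hS
    rw [abs_of_pos hsin, ← hid]
    field_simp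
    ring

/-- ★ THE MAIN TERM: `Σ_{p<2L} (1 − cos 2nu_p)·L/(4|sin u_p|) = L·Σ_{k<n} cos θ_k/sin θ_k`, `θ_k = (2k+1)π/(2L)` (`n ≤ L`). [folklore] -/
theorem main_term_eq (n : ℕ) (hn : n ≤ L) :
    ∑ p ∈ Finset.range (2 * L), (1 - Real.cos (2 * Real.pi * n * p / L)) * (L / (4 * |Real.sin (Real.pi * p / L)|))
      = L * ∑ k ∈ Finset.range n,
          Real.cos ((2 * k + 1) * Real.pi / (2 * L)) / Real.sin ((2 * k + 1) * Real.pi / (2 * L)) := by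
  have hL1 : 1 ≤ L := Nat.pos_of_ne_zero (NeZero.ne L)
  -- split the period into two half-periods and use the shift invariance
  rw [← Finset.sum_range_add_sum_Ico _ (show L ≤ 2 * L by omega), Finset.sum_Ico_eq_sum_range,
    show 2 * L - L = L by omega]
  simp only [main_summand_shift]
  rw [← two_mul]
  -- first half-period: odd sine sums
  rw [Finset.sum_congr rfl fun p hp => main_summand_eq_sum_sin L n p (Finset.mem_range.mp hp), ← Finset.mul_sum,
    Finset.sum_comm]
  have hk : ∀ k ∈ Finset.range n, ∑ p ∈ Finset.range L, Real.sin ((2 * k + 1) * (Real.pi * p / L))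
      = Real.cos ((2 * k + 1) * Real.pi / (2 * L)) / Real.sin ((2 * k + 1) * Real.pi / (2 * L)) := by
    intro k hk
    have hk' : 2 * k + 1 < 2 * L := by have := Finset.mem_range.mp hk; omega
    rw [← sum_sin_odd_eq_cot L k hL1 hk']
    refine Finset.sum_congr rfl fun p _ => ?_
    congr 1; ring
  rw [Finset.sum_congr rfl hk]
  ring

/-! ## The diagonal values -/

/-- ★★ **`|a_L(n,n;0) − (1/π)Σ_{k<n} 1/(2k+1)| ≤ n²/L + πn²/(8L²)`** for `2n ≤ L`. [folklore] -/
theorem aKer_diag_approx (n : ℕ) (hn : 2 * n ≤ L) :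
    |aKer L 0 ((n : ZMod L), (n : ZMod L)) - 1 / Real.pi * ∑ k ∈ Finset.range n, 1 / (2 * (k : ℝ) + 1)|
      ≤ (n : ℝ) ^ 2 / L + Real.pi * (n : ℝ) ^ 2 / (8 * (L : ℝ) ^ 2) := by
  have hL0 : (0 : ℝ) < L := by exact_mod_cast Nat.pos_of_ne_zero (NeZero.ne L)
  have hπ := Real.pi_pos
  have hD := diag_rotation L 0 n
  -- the row decomposition
  set R : ℕ → ℝ := fun p => (1 - Real.cos (2 * Real.pi * n * p / L)) * ∑ j ∈ Finset.range L,
      1 / (4 - 0 - 4 * Real.cos (Real.pi * p / L) * Real.cos (Real.pi * ((2 * j + p % 2 : ℕ) : ℝ) / L)) with hR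
  set M : ℕ → ℝ := fun p => (1 - Real.cos (2 * Real.pi * n * p / L)) * (L / (4 * |Real.sin (Real.pi * p / L)|)) with hM
  have hsumR : 2 * (L : ℝ) ^ 2 * aKer L 0 ((n : ZMod L), (n : ZMod L)) = ∑ p ∈ Finset.range (2 * L), R p := by
    rw [hD]
  have hsumM : ∑ p ∈ Finset.range (2 * L), M p = L * ∑ k ∈ Finset.range n,
      Real.cos ((2 * k + 1) * Real.pi / (2 * L)) / Real.sin ((2 * k + 1) * Real.pi / (2 * L)) :=
    main_term_eq L n (by omega)
  have herr : |∑ p ∈ Finset.range (2 * L), R p - ∑ p ∈ Finset.range (2 * L), M p| ≤ 2 * L * (n : ℝ) ^ 2 := by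
    rw [← Finset.sum_sub_distrib]
    calc |∑ p ∈ Finset.range (2 * L), (R p - M p)| ≤ ∑ p ∈ Finset.range (2 * L), |R p - M p| :=
          Finset.abs_sum_le_sum_abs _ _
      _ ≤ ∑ p ∈ Finset.range (2 * L), (n : ℝ) ^ 2 := Finset.sum_le_sum fun p _ => row_bound L n p
      _ = 2 * L * (n : ℝ) ^ 2 := by rw [Finset.sum_const, Finset.card_range, nsmul_eq_mul]; push_cast; ring
  -- the cotangent sums against the harmonic-type limit
  have hcot : |1 / (2 * (L : ℝ)) * ∑ k ∈ Finset.range n,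
        Real.cos ((2 * k + 1) * Real.pi / (2 * L)) / Real.sin ((2 * k + 1) * Real.pi / (2 * L))
      - 1 / Real.pi * ∑ k ∈ Finset.range n, 1 / (2 * (k : ℝ) + 1)| ≤ Real.pi * (n : ℝ) ^ 2 / (8 * (L : ℝ) ^ 2) := by
    rw [Finset.mul_sum, Finset.mul_sum, ← Finset.sum_sub_distrib]
    have hk : ∀ k ∈ Finset.range n,
        |1 / (2 * (L : ℝ)) * (Real.cos ((2 * k + 1) * Real.pi / (2 * L)) / Real.sin ((2 * k + 1) * Real.pi / (2 * L)))
          - 1 / Real.pi * (1 / (2 * (k : ℝ) + 1))| ≤ (2 * (k : ℝ) + 1) * Real.pi / (8 * (L : ℝ) ^ 2) := by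
      intro k hk
      have hkn := Finset.mem_range.mp hk
      set θ : ℝ := (2 * k + 1) * Real.pi / (2 * L) with hθ
      have hθ0 : 0 < θ := by rw [hθ]; positivity
      have hθ1 : θ < Real.pi / 2 := by
        rw [hθ, div_lt_div_iff₀ (by positivity) (by norm_num)]
        have : (2 * (k : ℝ) + 1) < L := by
          have : 2 * k + 1 < L := by omega
          exact_mod_cast this
        nlinarith
      have hb := abs_theta_cot_sub_one_le hθ0 hθ1
      have hsinθ : Real.sin θ ≠ 0 := (Real.sin_pos_of_pos_of_lt_pi hθ0 (by linarith)).ne'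
      have h2Lθ : 1 / Real.pi * (1 / (2 * (k : ℝ) + 1)) = 1 / (2 * L * θ) := by
        rw [hθ]; field_simp
      have e : 1 / (2 * (L : ℝ)) * (Real.cos θ / Real.sin θ) - 1 / Real.pi * (1 / (2 * (k : ℝ) + 1))
          = (1 / (2 * L * θ)) * (θ * Real.cos θ / Real.sin θ - 1) := by
        rw [h2Lθ]
        field_simp
      rw [e, abs_mul, abs_of_pos (by positivity : (0 : ℝ) < 1 / (2 * L * θ))]
      calc 1 / (2 * L * θ) * |θ * Real.cos θ / Real.sin θ - 1| ≤ 1 / (2 * L * θ) * (θ ^ 2 / 2) :=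
            mul_le_mul_of_nonneg_left hb (by positivity)
        _ = (2 * (k : ℝ) + 1) * Real.pi / (8 * (L : ℝ) ^ 2) := by rw [hθ]; field_simp; ring
    calc _ ≤ ∑ k ∈ Finset.range n, |1 / (2 * (L : ℝ)) * (Real.cos ((2 * k + 1) * Real.pi / (2 * L))
            / Real.sin ((2 * k + 1) * Real.pi / (2 * L))) - 1 / Real.pi * (1 / (2 * (k : ℝ) + 1))| :=
          Finset.abs_sum_le_sum_abs _ _
      _ ≤ ∑ k ∈ Finset.range n, (2 * (k : ℝ) + 1) * Real.pi / (8 * (L : ℝ) ^ 2) := Finset.sum_le_sum hk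
      _ = Real.pi * (n : ℝ) ^ 2 / (8 * (L : ℝ) ^ 2) := by
          have hodd : ∀ m : ℕ, ∑ k ∈ Finset.range m, (2 * (k : ℝ) + 1) = (m : ℝ) ^ 2 := by
            intro m
            induction m with
            | zero => simp
            | succ m ih => rw [Finset.sum_range_succ, ih]; push_cast; ring
          rw [← Finset.sum_div, ← Finset.sum_mul, hodd]; ring
  -- assemble
  have hmain : |aKer L 0 ((n : ZMod L), (n : ZMod L)) - 1 / (2 * (L : ℝ)) * ∑ k ∈ Finset.range n,
      Real.cos ((2 * k + 1) * Real.pi / (2 * L)) / Real.sin ((2 * k + 1) * Real.pi / (2 * L))| ≤ (n : ℝ) ^ 2 / L := by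
    have e : aKer L 0 ((n : ZMod L), (n : ZMod L)) - 1 / (2 * (L : ℝ)) * ∑ k ∈ Finset.range n,
        Real.cos ((2 * k + 1) * Real.pi / (2 * L)) / Real.sin ((2 * k + 1) * Real.pi / (2 * L))
        = (∑ p ∈ Finset.range (2 * L), R p - ∑ p ∈ Finset.range (2 * L), M p) / (2 * (L : ℝ) ^ 2) := by
      rw [← hsumR, hsumM]
      set T := ∑ k ∈ Finset.range n,
        Real.cos ((2 * k + 1) * Real.pi / (2 * L)) / Real.sin ((2 * k + 1) * Real.pi / (2 * L)) with hT
      field_simp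
    rw [e, abs_div, abs_of_pos (by positivity : (0 : ℝ) < 2 * (L : ℝ) ^ 2), div_le_div_iff₀ (by positivity) hL0]
    nlinarith
  calc _ ≤ |aKer L 0 ((n : ZMod L), (n : ZMod L)) - 1 / (2 * (L : ℝ)) * ∑ k ∈ Finset.range n,
          Real.cos ((2 * k + 1) * Real.pi / (2 * L)) / Real.sin ((2 * k + 1) * Real.pi / (2 * L))|
        + |1 / (2 * (L : ℝ)) * ∑ k ∈ Finset.range n,
          Real.cos ((2 * k + 1) * Real.pi / (2 * L)) / Real.sin ((2 * k + 1) * Real.pi / (2 * L))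
        - 1 / Real.pi * ∑ k ∈ Finset.range n, 1 / (2 * (k : ℝ) + 1)| := abs_sub_le _ _ _
    _ ≤ _ := add_le_add hmain hcot

namespace Subsample

/-- ★★★ **THE DIAGONAL VALUES OF THE ℤ² KERNEL:** `a_∞(n,n) = (1/π)·Σ_{k<n} 1/(2k+1)` (McCrea–Whipple) for p2's `aZ2`. [folklore] -/
theorem aZ2_diag (n : ℕ) : aZ2 n n = 1 / Real.pi * ∑ k ∈ Finset.range n, 1 / (2 * (k : ℝ) + 1) := by
  set c : ℝ := 1 / Real.pi * ∑ k ∈ Finset.range n, 1 / (2 * (k : ℝ) + 1) with hc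
  have h1 := tendsto_aKer_aZ2 (n : ℤ) (n : ℤ)
  simp only [Int.cast_natCast] at h1
  -- the explicit rate along the dyadic moduli
  set g : ℕ → ℝ := fun k => ((n : ℝ) ^ 2 + Real.pi * (n : ℝ) ^ 2 / 8) * (1 / 2) ^ (k + 1) with hg
  have hg0 : Tendsto g atTop (𝓝 0) := by
    have h : Tendsto (fun k : ℕ => (1 / 2 : ℝ) ^ (k + 1)) atTop (𝓝 0) :=
      (tendsto_pow_atTop_nhds_zero_of_lt_one (by norm_num) (by norm_num)).comp (tendsto_add_atTop_nat 1)
    have := h.const_mul ((n : ℝ) ^ 2 + Real.pi * (n : ℝ) ^ 2 / 8)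
    rw [mul_zero] at this
    exact this
  have hbound : ∀ᶠ k : ℕ in atTop,
      ‖aKer (2 ^ (k + 1)) 0 (((n : ℕ) : ZMod (2 ^ (k + 1))), ((n : ℕ) : ZMod (2 ^ (k + 1)))) - c‖ ≤ g k := by
    refine Filter.eventually_atTop.mpr ⟨n, fun k hk => ?_⟩
    have hpow : 2 * n ≤ 2 ^ (k + 1) := by
      have : n < 2 ^ n := Nat.lt_two_pow_self
      have : 2 ^ n ≤ 2 ^ k := Nat.pow_le_pow_right (by norm_num) hk
      rw [pow_succ]; omega
    have h := aKer_diag_approx (2 ^ (k + 1)) n hpow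
    rw [Real.norm_eq_abs]
    refine h.trans ?_
    have hL1 : (1 : ℝ) ≤ ((2 ^ (k + 1) : ℕ) : ℝ) := by exact_mod_cast Nat.one_le_two_pow
    have hL0 : (0 : ℝ) < ((2 ^ (k + 1) : ℕ) : ℝ) := by linarith
    have e : (1 / 2 : ℝ) ^ (k + 1) = 1 / ((2 ^ (k + 1) : ℕ) : ℝ) := by push_cast; rw [one_div_pow]
    rw [hg]
    simp only
    rw [e]
    have h2 : Real.pi * (n : ℝ) ^ 2 / (8 * ((2 ^ (k + 1) : ℕ) : ℝ) ^ 2)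
        ≤ Real.pi * (n : ℝ) ^ 2 / 8 * (1 / ((2 ^ (k + 1) : ℕ) : ℝ)) := by
      have hinv : 1 / ((2 ^ (k + 1) : ℕ) : ℝ) ≤ 1 := by rw [div_le_one hL0]; exact hL1
      have ee : Real.pi * (n : ℝ) ^ 2 / (8 * ((2 ^ (k + 1) : ℕ) : ℝ) ^ 2)
          = Real.pi * (n : ℝ) ^ 2 / 8 * (1 / ((2 ^ (k + 1) : ℕ) : ℝ)) * (1 / ((2 ^ (k + 1) : ℕ) : ℝ)) := by
        field_simp
      rw [ee]
      exact mul_le_of_le_one_right (by positivity) hinv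
    have h3 : (n : ℝ) ^ 2 / ((2 ^ (k + 1) : ℕ) : ℝ) = (n : ℝ) ^ 2 * (1 / ((2 ^ (k + 1) : ℕ) : ℝ)) := by ring
    rw [h3, add_mul]
    linarith
  have h2 : Tendsto (fun k : ℕ =>
      aKer (2 ^ (k + 1)) 0 (((n : ℕ) : ZMod (2 ^ (k + 1))), ((n : ℕ) : ZMod (2 ^ (k + 1))))) atTop (𝓝 c) := by
    have hz := squeeze_zero_norm' hbound hg0
    have := hz.add (tendsto_const_nhds (x := c))
    rw [zero_add] at this
    exact this.congr fun k => by ring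
  exact tendsto_nhds_unique h1 h2

/-- ★★★ `a_∞(1,1) = 1/π`. [folklore] -/
theorem aZ2_one_one : aZ2 1 1 = 1 / Real.pi := by
  have h := aZ2_diag 1
  norm_num at h
  simpa [one_div] using h

/-- ★★★ `a_∞(2,2) = 4/(3π)`. [folklore] -/
theorem aZ2_two_two : aZ2 2 2 = 4 / (3 * Real.pi) := by
  have h := aZ2_diag 2
  rw [Finset.sum_range_succ, Finset.sum_range_one] at h
  norm_num at h
  rw [h]; ring

/-- ★★★ `a_∞(3,3) = 23/(15π)`. [folklore] -/
theorem aZ2_three_three : aZ2 3 3 = 23 / (15 * Real.pi) := by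
  have h := aZ2_diag 3
  rw [Finset.sum_range_succ, Finset.sum_range_succ, Finset.sum_range_one] at h
  norm_num at h
  rw [h]; ring

/-- `a_∞(2,0) = 1 − 2/π`. [folklore] -/
theorem aZ2_two_zero' : aZ2 2 0 = 1 - 2 / Real.pi := by
  rw [aZ2_two_zero, aZ2_one_one]; ring

/-- `a_∞(2,1) = 2/π − 1/4`. [folklore] -/
theorem aZ2_two_one' : aZ2 2 1 = 2 / Real.pi - 1 / 4 := by
  rw [aZ2_two_one, aZ2_one_one]; ring

/-- `a_∞(3,0) = 17/4 − 12/π`. [folklore] -/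
theorem aZ2_three_zero' : aZ2 3 0 = 17 / 4 - 12 / Real.pi := by
  rw [aZ2_three_zero, aZ2_one_one]; ring

/-- `a_∞(3,1) = 23/(3π) − 2`. [folklore] -/
theorem aZ2_three_one' : aZ2 3 1 = 23 / (3 * Real.pi) - 2 := by
  have h := aZ2_three_one_add_two_two
  rw [aZ2_two_two, aZ2_one_one] at h
  have hπ := Real.pi_pos
  field_simp at h
  field_simp
  linarith

/-- `a_∞(3,2) = 2/(3π) + 1/4` (harmonicity at `(2,2)`). [folklore] -/
theorem aZ2_three_two' : aZ2 3 2 = 2 / (3 * Real.pi) + 1 / 4 := by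
  have h := aZ2_harmonic 2 2
  norm_num at h
  rw [aZ2_swap 2 1, aZ2_swap 3 2, aZ2_two_one', aZ2_two_two] at h
  have hπ := Real.pi_pos
  field_simp at h
  field_simp
  linarith

/-- ★★★ **the ℤ² window is `aInfKT`, unconditionally:** `aZ2 x y = aInfKT x y` for `0 ≤ y ≤ x ≤ 3`. [folklore] -/
theorem aZ2_eq_aInfKT {x y : ℕ} (hyx : y ≤ x) (hx3 : x ≤ 3) : aZ2 x y = aInfKT x y := by
  interval_cases x <;> interval_cases y
  · simpa [aInfKT] using aZ2_zero
  · simpa [aInfKT] using aZ2_one_zero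
  · simpa [aInfKT] using aZ2_one_one
  · simpa [aInfKT] using aZ2_two_zero'
  · simpa [aInfKT] using aZ2_two_one'
  · simpa [aInfKT] using aZ2_two_two
  · simpa [aInfKT] using aZ2_three_zero'
  · simpa [aInfKT] using aZ2_three_one'
  · simpa [aInfKT] using aZ2_three_two'
  · simpa [aInfKT] using aZ2_three_three

end Subsample

end Summit.HubbardSuperconductivity.HubbardSuperconductivity.Theorems.AnisotropyChord.Transfer.Fibre3

end
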